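import Mathlib
import Literature.NumberTheory.LFunctions.Zhang2022.Section18RangeTools
import HarnessLib

/-!
# Zhang (2022) §18, proof of (2.33): the `(d,r)` double-sum majorant on a window

Topic `Literature/NumberTheory/LFunctions/Zhang2022` (Landau–Siegel audit tree; verdict-neutral).
Y. Zhang, *Discrete mean estimates and the Landau–Siegel zero*, arXiv:2211.02515v1 (2022)
[Zhang2022LandauSiegel], §18 p. 100 — an unrefereed manuscript under adjudication (campaign D-0069,
layer L4; cone leaf C27 `Skeleton.Ded183`; GAP-LEDGER row G-d56-1, component K2). The range
evaluations of `S_j(𝐚₂₃,𝐚₂₃) = Σ_rΣ_d w(d,r)𝔳₁ⱼ(dr)𝔳₂ⱼ(d,r)`, `|w(d,r)| ≤ ∏_{q∣dr}(1+c/q)/(drφ(r))`,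
need the mass of the weights on a multiplicative window `Y < dr ≤ Z` (the `T`-windows of Lemmas
10.1–10.2 and the error terms). PROVED here from the definitions:

* `sum_sq_prod_one_add_div_le` — `Σ_{1≤r≤X} r⁻²∏_{q∣r}(1 + c/q) ≤ 2eᶜ`;
* `sum_box_window_le` — `Σ_{r,d∈[1,N), Y<dr≤Z} ∏_{q∣dr}(1+c/q)/(d·r·φ(r)) ≤ 2e^{3c+2}(2 + log(Z/Y))`
  for `c ≥ 0`, `1 ≤ Y ≤ Z` (via `h(dr) ≤ h(d)h(r)`, `r/φ(r) ≤ ∏_{q∣r}(1+2/q)`, the windowed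
  majorant `sum_Ioc_prod_one_add_div_le` in `d` and `sum_sq_prod_one_add_div_le` in `r`).

No claim of the manuscript is asserted; nothing bears on Theorems 1–2.

## References

* Y. Zhang, arXiv:2211.02515v1 (2022), §18 p. 100; §10 (10.5), (10.11). [cite: Zhang2022LandauSiegel, §18 p.100]
-/

noncomputable section

open Real Finset

namespace Literature.NumberTheory.LFunctions.Zhang2022.Sec18SjNorm

section DoubleSum

/-- `∏_{q∣n}(1 + c/q) ≥ 1` for `c ≥ 0`. [folklore] -/
private theorem one_le_prodMaj {c : ℝ} (hc : 0 ≤ c) (n : ℕ) :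
    1 ≤ ∏ q ∈ n.primeFactors, (1 + c / (q : ℝ)) :=
  Finset.one_le_prod fun q _ => by
    have : 0 ≤ c / (q : ℝ) := by positivity
    linarith

/-- Sub-multiplicativity: `h(dr) ≤ h(d)h(r)` for `h(n) = ∏_{q∣n}(1 + c/q)`, `c ≥ 0`, `d, r ≥ 1`.
[folklore] -/
private theorem prodMaj_mul_le {c : ℝ} (hc : 0 ≤ c) {d r : ℕ} (hd : d ≠ 0) (hr : r ≠ 0) :
    ∏ q ∈ (d * r).primeFactors, (1 + c / (q : ℝ)) ≤
      (∏ q ∈ d.primeFactors, (1 + c / (q : ℝ))) * ∏ q ∈ r.primeFactors, (1 + c / (q : ℝ)) := by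
  rw [Nat.primeFactors_mul hd hr, ← prod_union_inter]
  have h1 : 1 ≤ ∏ q ∈ d.primeFactors ∩ r.primeFactors, (1 + c / (q : ℝ)) :=
    Finset.one_le_prod fun q _ => by
      have : 0 ≤ c / (q : ℝ) := by positivity
      linarith
  have h0 : 0 ≤ ∏ q ∈ d.primeFactors ∪ r.primeFactors, (1 + c / (q : ℝ)) :=
    prod_nonneg fun q _ => by positivity
  exact le_mul_of_one_le_right h0 h1

/-- `r/φ(r) ≤ ∏_{q∣r}(1 + 2/q)` for `r ≥ 1` (`q/(q−1) = 1 + 1/(q−1) ≤ 1 + 2/q`). [folklore] -/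
private theorem self_div_totient_le {r : ℕ} (hr : r ≠ 0) :
    (r : ℝ) / (Nat.totient r : ℝ) ≤ ∏ q ∈ r.primeFactors, (1 + 2 / (q : ℝ)) := by
  have hφ : (0 : ℝ) < Nat.totient r := by exact_mod_cast Nat.totient_pos.mpr (Nat.pos_of_ne_zero hr)
  have hrR : (0 : ℝ) < r := by exact_mod_cast Nat.pos_of_ne_zero hr
  have hφeq : (Nat.totient r : ℝ) = r * ∏ q ∈ r.primeFactors, (1 - 1 / (q : ℝ)) :=
    MertensBound.totient_eq_mul_prod_one_sub_inv r
  rw [div_le_iff₀ hφ, hφeq, ← mul_assoc, mul_comm _ (r : ℝ), mul_assoc, ← prod_mul_distrib]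
  apply le_mul_of_one_le_right hrR.le
  refine Finset.one_le_prod fun q hq => ?_
  have hq2 : (2 : ℝ) ≤ q := by exact_mod_cast (Nat.prime_of_mem_primeFactors hq).two_le
  have hq0 : (0 : ℝ) < q := by linarith
  -- `(1 + 2/q)(1 − 1/q) = 1 + 1/q − 2/q² ≥ 1`
  have e : (1 + 2 / (q : ℝ)) * (1 - 1 / (q : ℝ)) = 1 + ((q : ℝ) - 2) / (q : ℝ) ^ 2 := by
    field_simp; ring
  rw [e]
  have : 0 ≤ ((q : ℝ) - 2) / (q : ℝ) ^ 2 := div_nonneg (by linarith) (by positivity)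
  linarith

/-- `Σ_{q ≤ X prime} 1/q² ≤ 1`. [folklore] -/
private theorem sum_primes_inv_sq_le_one'' (X : ℕ) :
    ∑ q ∈ (range (X + 1)).filter Nat.Prime, ((q : ℝ) ^ 2)⁻¹ ≤ 1 := by
  have hsub : (range (X + 1)).filter Nat.Prime ⊆ Ioo 1 (X + 1) := by
    intro q hq
    rw [mem_filter, mem_range] at hq
    exact mem_Ioo.mpr ⟨hq.2.one_lt, hq.1⟩
  calc ∑ q ∈ (range (X + 1)).filter Nat.Prime, ((q : ℝ) ^ 2)⁻¹
      ≤ ∑ q ∈ Ioo 1 (X + 1), ((q : ℝ) ^ 2)⁻¹ :=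
        sum_le_sum_of_subset_of_nonneg hsub fun q _ _ => by positivity
    _ ≤ 2 / (1 + 1) := by exact_mod_cast sum_Ioo_inv_sq_le (α := ℝ) 1 (X + 1)
    _ = 1 := by norm_num

/-- **`Σ_{1≤r≤X} r⁻² ∏_{q∣r}(1 + c/q) ≤ 2eᶜ`** for `c ≥ 0` (expand over subsets `T` of the prime
factors; `Σ_{∏T ∣ r} r⁻² ≤ (∏T)⁻²·2`; `Σ_T ∏_{q∈T} c/q³ = ∏_q(1 + c/q³) ≤ eᶜ`).
[cite: Zhang2022LandauSiegel, §18 p.100] -/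
theorem sum_sq_prod_one_add_div_le {c : ℝ} (hc : 0 ≤ c) (X : ℕ) :
    ∑ r ∈ Icc 1 X, (∏ q ∈ r.primeFactors, (1 + c / (q : ℝ))) / (r : ℝ) ^ 2 ≤ 2 * Real.exp c := by
  classical
  set P : Finset ℕ := (range (X + 1)).filter Nat.Prime with hP
  have hexp : ∀ r : ℕ, (∏ q ∈ r.primeFactors, (1 + c / (q : ℝ))) / (r : ℝ) ^ 2 =
      ∑ T ∈ r.primeFactors.powerset, (∏ q ∈ T, (c / (q : ℝ))) / (r : ℝ) ^ 2 := by
    intro r; rw [prod_one_add, sum_div]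
  rw [sum_congr rfl fun r _ => hexp r]
  have hswap : ∑ r ∈ Icc 1 X, ∑ T ∈ r.primeFactors.powerset, (∏ q ∈ T, (c / (q : ℝ))) / (r : ℝ) ^ 2 =
      ∑ T ∈ P.powerset, ∑ r ∈ (Icc 1 X).filter (fun r => T ⊆ r.primeFactors),
        (∏ q ∈ T, (c / (q : ℝ))) / (r : ℝ) ^ 2 := by
    refine sum_comm' fun r T => ?_
    simp only [mem_powerset, mem_filter, mem_Icc]
    constructor
    · rintro ⟨⟨h1, hX⟩, hT⟩
      refine ⟨⟨⟨h1, hX⟩, hT⟩, hT.trans fun q hq => ?_⟩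
      rw [hP, mem_filter, mem_range]
      have hq' := Nat.mem_primeFactors.mp hq
      exact ⟨Nat.lt_succ_of_le (le_trans (Nat.le_of_dvd h1 hq'.2.1) hX), hq'.1⟩
    · rintro ⟨⟨⟨h1, hX⟩, hT⟩, _⟩
      exact ⟨⟨h1, hX⟩, hT⟩
  rw [hswap]
  -- inner sums: `Σ_{r ≤ X, ∏T ∣ r} 1/r² ≤ 2/(∏T)²`
  have hinner : ∀ T ∈ P.powerset,
      ∑ r ∈ (Icc 1 X).filter (fun r => T ⊆ r.primeFactors), (∏ q ∈ T, (c / (q : ℝ))) / (r : ℝ) ^ 2 ≤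
        2 * ∏ q ∈ T, (c / (q : ℝ) ^ 3) := by
    intro T hT
    rw [mem_powerset] at hT
    have hTprime : ∀ q ∈ T, q.Prime := fun q hq => by
      have := hT hq; rw [hP, mem_filter] at this; exact this.2
    set d : ℕ := ∏ q ∈ T, q with hd
    have hdpos : 0 < d := prod_pos fun q hq => (hTprime q hq).pos
    have hdR : (d : ℝ) = ∏ q ∈ T, (q : ℝ) := by rw [hd]; push_cast; rfl
    have hcT : 0 ≤ ∏ q ∈ T, (c / (q : ℝ)) := prod_nonneg fun q _ => by positivity
    -- `T ⊆ pf r ⇒ d ∣ r`, and the multiples of `d` in `[1,X]` are among `d·m`, `m ∈ [1,X]`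
    have hsub : (Icc 1 X).filter (fun r => T ⊆ r.primeFactors) ⊆ (Icc 1 X).image (fun m => d * m) := by
      intro r hr
      rw [mem_filter, mem_Icc] at hr
      obtain ⟨⟨h1, hX⟩, hTr⟩ := hr
      have hdr : d ∣ r := by
        rw [hd]
        exact Finset.prod_primes_dvd r (fun q hq => (hTprime q hq).prime)
          fun q hq => (Nat.mem_primeFactors.mp (hTr hq)).2.1
      obtain ⟨m, rfl⟩ := hdr
      rw [mem_image]
      refine ⟨m, mem_Icc.mpr ⟨?_, ?_⟩, rfl⟩
      · rcases Nat.eq_zero_or_pos m with h0 | h0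
        · simp [h0] at h1
        · exact h0
      · exact le_trans (Nat.le_mul_of_pos_left m hdpos) hX
    have hinj : Set.InjOn (fun m => d * m) ((Icc 1 X : Finset ℕ) : Set ℕ) := by
      intro a _ b _ hab; exact Nat.eq_of_mul_eq_mul_left hdpos hab
    have hsq : ∑ m ∈ Icc 1 X, (((m : ℕ) : ℝ) ^ 2)⁻¹ ≤ 2 := by
      have hsub' : Icc 1 X ⊆ Ioo 0 (X + 1) := by
        intro m hm; rw [mem_Icc] at hm; exact mem_Ioo.mpr ⟨hm.1, Nat.lt_succ_of_le hm.2⟩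
      calc ∑ m ∈ Icc 1 X, (((m : ℕ) : ℝ) ^ 2)⁻¹ ≤ ∑ m ∈ Ioo 0 (X + 1), (((m : ℕ) : ℝ) ^ 2)⁻¹ :=
            sum_le_sum_of_subset_of_nonneg hsub' fun m _ _ => by positivity
        _ ≤ 2 / (0 + 1) := by exact_mod_cast sum_Ioo_inv_sq_le (α := ℝ) 0 (X + 1)
        _ = 2 := by norm_num
    calc ∑ r ∈ (Icc 1 X).filter (fun r => T ⊆ r.primeFactors), (∏ q ∈ T, (c / (q : ℝ))) / (r : ℝ) ^ 2
        = (∏ q ∈ T, (c / (q : ℝ))) *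
            ∑ r ∈ (Icc 1 X).filter (fun r => T ⊆ r.primeFactors), ((r : ℝ) ^ 2)⁻¹ := by
          rw [mul_sum]; refine sum_congr rfl fun r _ => ?_; rw [div_eq_mul_inv]
      _ ≤ (∏ q ∈ T, (c / (q : ℝ))) * ∑ r ∈ (Icc 1 X).image (fun m => d * m), ((r : ℝ) ^ 2)⁻¹ :=
          mul_le_mul_of_nonneg_left
            (sum_le_sum_of_subset_of_nonneg hsub fun r _ _ => by positivity) hcT
      _ = (∏ q ∈ T, (c / (q : ℝ))) * ∑ m ∈ Icc 1 X, (((d * m : ℕ) : ℝ) ^ 2)⁻¹ := by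
          rw [sum_image hinj]
      _ = (∏ q ∈ T, (c / (q : ℝ))) * (((d : ℝ) ^ 2)⁻¹ * ∑ m ∈ Icc 1 X, (((m : ℕ) : ℝ) ^ 2)⁻¹) := by
          congr 1
          rw [mul_sum]
          refine sum_congr rfl fun m _ => ?_
          push_cast
          rw [mul_pow, mul_inv]
      _ ≤ (∏ q ∈ T, (c / (q : ℝ))) * (((d : ℝ) ^ 2)⁻¹ * 2) := by gcongr
      _ = 2 * ((∏ q ∈ T, (c / (q : ℝ))) / (∏ q ∈ T, (q : ℝ)) ^ 2) := by rw [hdR]; ring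
      _ = 2 * ∏ q ∈ T, (c / (q : ℝ) ^ 3) := by
          rw [← prod_pow, ← prod_div_distrib]
          congr 1
          refine prod_congr rfl fun q _ => ?_
          rw [div_div]; ring
  calc ∑ T ∈ P.powerset, ∑ r ∈ (Icc 1 X).filter (fun r => T ⊆ r.primeFactors),
          (∏ q ∈ T, (c / (q : ℝ))) / (r : ℝ) ^ 2
      ≤ ∑ T ∈ P.powerset, 2 * ∏ q ∈ T, (c / (q : ℝ) ^ 3) := sum_le_sum hinner
    _ = 2 * ∏ q ∈ P, (1 + c / (q : ℝ) ^ 3) := by rw [← mul_sum, prod_one_add]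
    _ ≤ 2 * Real.exp (∑ q ∈ P, c / (q : ℝ) ^ 3) := by
        gcongr; exact Real.prod_one_add_le_exp_sum P fun q => by positivity
    _ ≤ 2 * Real.exp c := by
        gcongr
        calc ∑ q ∈ P, c / (q : ℝ) ^ 3 ≤ ∑ q ∈ P, c * ((q : ℝ) ^ 2)⁻¹ := by
              refine sum_le_sum fun q hq => ?_
              have hq1 : (1 : ℝ) ≤ q := by
                rw [hP, mem_filter] at hq; exact_mod_cast hq.2.one_lt.le
              have hq0 : (0 : ℝ) < q := by linarith
              calc c / (q : ℝ) ^ 3 = c * ((q : ℝ) ^ 2)⁻¹ * (q : ℝ)⁻¹ := by field_simp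
                _ ≤ c * ((q : ℝ) ^ 2)⁻¹ :=
                    mul_le_of_le_one_right (by positivity) (inv_le_one_of_one_le₀ hq1)
          _ = c * ∑ q ∈ P, ((q : ℝ) ^ 2)⁻¹ := by rw [mul_sum]
          _ ≤ c * 1 := by gcongr; exact sum_primes_inv_sq_le_one'' X
          _ = c := mul_one c

/-- The window sum in `d` at fixed `r ≥ 1`: for `c ≥ 0`, `1 ≤ Y ≤ Z` and any `N`,
`Σ_{d∈[1,N), Y<dr≤Z} d⁻¹∏_{q∣d}(1+c/q) ≤ eᶜ(2 + log(Z/Y))` (the `d`-range is `(Y/r, Z/r]`; if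
`r > Y` it is `[1, Z/r]` with `Z/r < Z/Y`, else `⌊Y/r⌋ ≥ Y/(2r)`). [cite: Zhang2022LandauSiegel, §18 p.100] -/
theorem sum_window_d_le {c : ℝ} (hc : 0 ≤ c) {Y Z : ℕ} (hY : 1 ≤ Y) (hYZ : Y ≤ Z) {r : ℕ}
    (hr : 1 ≤ r) (N : ℕ) :
    ∑ d ∈ (Ico 1 N).filter (fun d => Y < d * r ∧ d * r ≤ Z),
        (∏ q ∈ d.primeFactors, (1 + c / (q : ℝ))) / (d : ℝ) ≤
      Real.exp c * (2 + Real.log ((Z : ℝ) / Y)) := by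
  have hr0 : 0 < r := hr
  have hYR : (0 : ℝ) < Y := by exact_mod_cast hY
  have hrR : (0 : ℝ) < r := by exact_mod_cast hr0
  have hZY : (1 : ℝ) ≤ (Z : ℝ) / Y := by
    rw [le_div_iff₀ hYR]; exact_mod_cast (by simpa using hYZ)
  have hlog0 : 0 ≤ Real.log ((Z : ℝ) / Y) := Real.log_nonneg hZY
  have hnonneg : ∀ d : ℕ, 0 ≤ (∏ q ∈ d.primeFactors, (1 + c / (q : ℝ))) / (d : ℝ) := fun d =>
    div_nonneg (prod_nonneg fun q _ => by positivity) (Nat.cast_nonneg d)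
  -- the `d`-range sits inside `Ioc (Y/r) (Z/r)`
  have hsub : (Ico 1 N).filter (fun d => Y < d * r ∧ d * r ≤ Z) ⊆ Ioc (Y / r) (Z / r) := by
    intro d hd
    rw [mem_filter] at hd
    rw [mem_Ioc]
    exact ⟨Nat.div_lt_of_lt_mul (by rw [mul_comm]; exact hd.2.1), (Nat.le_div_iff_mul_le hr0).mpr hd.2.2⟩
  refine (sum_le_sum_of_subset_of_nonneg hsub fun d _ _ => hnonneg d).trans ?_
  rcases Nat.eq_zero_or_pos (Y / r) with h0 | hpos
  · -- `r > Y`: the range is `[1, Z/r]`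
    rw [h0, ← Finset.Icc_add_one_left_eq_Ioc, zero_add]
    refine (sum_prod_one_add_div_le hc (Z / r)).trans ?_
    have hZr : Real.log ((Z / r : ℕ) : ℝ) ≤ Real.log ((Z : ℝ) / Y) := by
      rcases Nat.eq_zero_or_pos (Z / r) with hz | hz
      · rw [hz, Nat.cast_zero, Real.log_zero]; exact hlog0
      · apply Real.log_le_log (by exact_mod_cast hz)
        have hYr : Y < r := by
          by_contra h; push Not at h
          exact absurd h0 (Nat.div_pos h hr0).ne'
        calc ((Z / r : ℕ) : ℝ) ≤ (Z : ℝ) / r := Nat.cast_div_le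
          _ ≤ (Z : ℝ) / Y := div_le_div_of_nonneg_left (Nat.cast_nonneg Z) hYR (by exact_mod_cast hYr.le)
    have := Real.exp_pos c
    nlinarith
  · -- `r ≤ Y`: windowed majorant on `(⌊Y/r⌋, ⌊Z/r⌋]`, and `⌊Z/r⌋/⌊Y/r⌋ ≤ 2Z/Y`
    have hab : Y / r ≤ Z / r := Nat.div_le_div_right hYZ
    refine (sum_Ioc_prod_one_add_div_le hc hpos hab).trans ?_
    have haR : (0 : ℝ) < ((Y / r : ℕ) : ℝ) := by exact_mod_cast hpos
    have hratio : ((Z / r : ℕ) : ℝ) / ((Y / r : ℕ) : ℝ) ≤ 2 * ((Z : ℝ) / Y) := by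
      -- `⌊Z/r⌋ ≤ Z/r` and `⌊Y/r⌋ ≥ Y/(2r)` (as `Y/r ≥ 1`)
      have h1 : ((Z / r : ℕ) : ℝ) ≤ (Z : ℝ) / r := Nat.cast_div_le
      have h2 : (Y : ℝ) / r ≤ 2 * ((Y / r : ℕ) : ℝ) := by
        -- `Y < (Y/r + 1) r ≤ 2 (Y/r) r` since `Y/r ≥ 1`
        have h' : Y < (Y / r + 1) * r := (Nat.div_lt_iff_lt_mul hr0).mp (Nat.lt_succ_self _)
        have h'' : (Y / r + 1) * r ≤ 2 * (Y / r) * r := by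
          apply Nat.mul_le_mul_right; omega
        rw [div_le_iff₀ hrR]
        exact_mod_cast (h'.trans_le h'').le
      rw [div_le_iff₀ haR]
      calc ((Z / r : ℕ) : ℝ) ≤ (Z : ℝ) / r := h1
        _ = (Z : ℝ) / Y * ((Y : ℝ) / r) := by field_simp
        _ ≤ (Z : ℝ) / Y * (2 * ((Y / r : ℕ) : ℝ)) := by gcongr
        _ = 2 * ((Z : ℝ) / Y) * ((Y / r : ℕ) : ℝ) := by ring
    have hlog2 : Real.log 2 ≤ 1 := by
      have := Real.log_lt_sub_one_of_pos (by norm_num : (0:ℝ) < 2) (by norm_num); linarith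
    have hl : Real.log (((Z / r : ℕ) : ℝ) / ((Y / r : ℕ) : ℝ)) ≤ 1 + Real.log ((Z : ℝ) / Y) := by
      have hbpos : (0 : ℝ) < ((Z / r : ℕ) : ℝ) := by
        exact_mod_cast Nat.lt_of_lt_of_le hpos hab
      calc Real.log (((Z / r : ℕ) : ℝ) / ((Y / r : ℕ) : ℝ)) ≤ Real.log (2 * ((Z : ℝ) / Y)) :=
            Real.log_le_log (div_pos hbpos haR) hratio
        _ = Real.log 2 + Real.log ((Z : ℝ) / Y) := by
            rw [Real.log_mul (by norm_num) (by positivity)]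
        _ ≤ 1 + Real.log ((Z : ℝ) / Y) := by linarith
    have := Real.exp_pos c
    nlinarith

/-- **K2 (double sum). The mass of the `(d,r)`-weights on a window**: for `c ≥ 0`, `1 ≤ Y ≤ Z`, any `N`,
`Σ_{r,d∈[1,N), Y<dr≤Z} ∏_{q∣dr}(1+c/q)/(d·r·φ(r)) ≤ 2e^{3c+2}(2 + log(Z/Y))`
(`h(dr) ≤ h(d)h(r)`; `r/φ(r) ≤ ∏_{q∣r}(1+2/q)` and `(1+c/q)(1+2/q) ≤ 1+(2c+2)/q`; then
`sum_window_d_le` in `d` and `sum_sq_prod_one_add_div_le` in `r`). [cite: Zhang2022LandauSiegel, §18 p.100] -/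
theorem sum_box_window_le {c : ℝ} (hc : 0 ≤ c) {Y Z : ℕ} (hY : 1 ≤ Y) (hYZ : Y ≤ Z) (N : ℕ) :
    ∑ r ∈ Ico 1 N, ∑ d ∈ Ico 1 N,
        (if Y < d * r ∧ d * r ≤ Z then
          (∏ q ∈ (d * r).primeFactors, (1 + c / (q : ℝ))) / ((d : ℝ) * r * Nat.totient r) else 0) ≤
      2 * Real.exp (3 * c + 2) * (2 + Real.log ((Z : ℝ) / Y)) := by
  have hYR : (0 : ℝ) < Y := by exact_mod_cast hY
  have hZY : (1 : ℝ) ≤ (Z : ℝ) / Y := by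
    rw [le_div_iff₀ hYR]; exact_mod_cast (by simpa using hYZ)
  have hW : 0 ≤ 2 + Real.log ((Z : ℝ) / Y) := by have := Real.log_nonneg hZY; linarith
  set h : ℕ → ℝ := fun n => ∏ q ∈ n.primeFactors, (1 + c / (q : ℝ)) with hh
  set g : ℕ → ℝ := fun n => ∏ q ∈ n.primeFactors, (1 + (2 * c + 2) / (q : ℝ)) with hg
  have hh0 : ∀ n, 0 ≤ h n := fun n => prod_nonneg fun q _ => by positivity
  -- per `r`: the inner `d`-sum is `≤ h(r)/(rφ(r)) · eᶜ(2 + log(Z/Y))`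
  have hinner : ∀ r ∈ Ico 1 N,
      ∑ d ∈ Ico 1 N, (if Y < d * r ∧ d * r ≤ Z then
          h (d * r) / ((d : ℝ) * r * Nat.totient r) else 0) ≤
        h r / ((r : ℝ) * Nat.totient r) * (Real.exp c * (2 + Real.log ((Z : ℝ) / Y))) := by
    intro r hr
    have hr1 : 1 ≤ r := (mem_Ico.mp hr).1
    have hr0 : r ≠ 0 := by omega
    have hrR : (0 : ℝ) < r := by exact_mod_cast hr1
    have hφ : (0 : ℝ) < Nat.totient r := by exact_mod_cast Nat.totient_pos.mpr hr1
    rw [← sum_filter]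
    calc ∑ d ∈ (Ico 1 N).filter (fun d => Y < d * r ∧ d * r ≤ Z), h (d * r) / ((d : ℝ) * r * Nat.totient r)
        ≤ ∑ d ∈ (Ico 1 N).filter (fun d => Y < d * r ∧ d * r ≤ Z),
            h r / ((r : ℝ) * Nat.totient r) * (h d / d) := by
          refine sum_le_sum fun d hd => ?_
          have hd1 : 1 ≤ d := (mem_Ico.mp (mem_filter.mp hd).1).1
          have hdR : (0 : ℝ) < d := by exact_mod_cast hd1
          have hsub := prodMaj_mul_le hc (by omega : d ≠ 0) hr0
          rw [div_le_iff₀ (by positivity)]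
          calc h (d * r) ≤ h d * h r := hsub
            _ = h r / ((r : ℝ) * Nat.totient r) * (h d / d) * ((d : ℝ) * r * Nat.totient r) := by
                field_simp
      _ = h r / ((r : ℝ) * Nat.totient r) *
            ∑ d ∈ (Ico 1 N).filter (fun d => Y < d * r ∧ d * r ≤ Z), h d / d := by rw [mul_sum]
      _ ≤ h r / ((r : ℝ) * Nat.totient r) * (Real.exp c * (2 + Real.log ((Z : ℝ) / Y))) :=
          mul_le_mul_of_nonneg_left (sum_window_d_le hc hY hYZ hr1 N)
            (div_nonneg (hh0 r) (by positivity))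
  -- the `r`-weights: `h(r)/(rφ(r)) ≤ g(r)/r²`
  have hweight : ∀ r ∈ Ico 1 N, h r / ((r : ℝ) * Nat.totient r) ≤ g r / (r : ℝ) ^ 2 := by
    intro r hr
    have hr1 : 1 ≤ r := (mem_Ico.mp hr).1
    have hr0 : r ≠ 0 := by omega
    have hrR : (0 : ℝ) < r := by exact_mod_cast hr1
    have hφ : (0 : ℝ) < Nat.totient r := by exact_mod_cast Nat.totient_pos.mpr hr1
    have h1 : h r / ((r : ℝ) * Nat.totient r) = h r * ((r : ℝ) / Nat.totient r) / (r : ℝ) ^ 2 := by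
      field_simp
    rw [h1]
    refine div_le_div_of_nonneg_right ?_ (by positivity)
    calc h r * ((r : ℝ) / Nat.totient r) ≤ h r * ∏ q ∈ r.primeFactors, (1 + 2 / (q : ℝ)) :=
          mul_le_mul_of_nonneg_left (self_div_totient_le hr0) (hh0 r)
      _ = ∏ q ∈ r.primeFactors, ((1 + c / (q : ℝ)) * (1 + 2 / (q : ℝ))) := by
          rw [hh, ← prod_mul_distrib]
      _ ≤ g r := by
          rw [hg]
          refine prod_le_prod (fun q _ => by positivity) fun q hq => ?_
          have hq2 : (2 : ℝ) ≤ q := by exact_mod_cast (Nat.prime_of_mem_primeFactors hq).two_le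
          have hq0 : (0 : ℝ) < q := by linarith
          -- `(1 + c/q)(1 + 2/q) = 1 + (c+2)/q + 2c/q² ≤ 1 + (2c+2)/q`
          rw [show (1 + c / (q : ℝ)) * (1 + 2 / (q : ℝ)) = 1 + (c + 2) / q + 2 * c / (q : ℝ) ^ 2 by
            field_simp; ring]
          have : 2 * c / (q : ℝ) ^ 2 ≤ c / q := by
            rw [div_le_div_iff₀ (by positivity) hq0]
            have hcq : 0 ≤ c * (q : ℝ) * ((q : ℝ) - 2) :=
              mul_nonneg (mul_nonneg hc hq0.le) (by linarith)
            nlinarith [hcq]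
          have e : 1 + (2 * c + 2) / (q : ℝ) = 1 + (c + 2) / q + c / q := by ring
          rw [e]; linarith
  have hIcc : Ico 1 N = Icc 1 (N - 1) := by ext n; simp only [mem_Ico, mem_Icc]; omega
  calc ∑ r ∈ Ico 1 N, ∑ d ∈ Ico 1 N, (if Y < d * r ∧ d * r ≤ Z then
          h (d * r) / ((d : ℝ) * r * Nat.totient r) else 0)
      ≤ ∑ r ∈ Ico 1 N, h r / ((r : ℝ) * Nat.totient r) * (Real.exp c * (2 + Real.log ((Z : ℝ) / Y))) :=
        sum_le_sum hinner
    _ = (∑ r ∈ Ico 1 N, h r / ((r : ℝ) * Nat.totient r)) * (Real.exp c * (2 + Real.log ((Z : ℝ) / Y))) := by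
        rw [sum_mul]
    _ ≤ (∑ r ∈ Ico 1 N, g r / (r : ℝ) ^ 2) * (Real.exp c * (2 + Real.log ((Z : ℝ) / Y))) :=
        mul_le_mul_of_nonneg_right (sum_le_sum hweight) (by positivity)
    _ ≤ (2 * Real.exp (2 * c + 2)) * (Real.exp c * (2 + Real.log ((Z : ℝ) / Y))) := by
        apply mul_le_mul_of_nonneg_right _ (by positivity)
        rw [hIcc]
        exact sum_sq_prod_one_add_div_le (by linarith) (N - 1)
    _ = 2 * Real.exp (3 * c + 2) * (2 + Real.log ((Z : ℝ) / Y)) := by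
        have e : Real.exp (3 * c + 2) = Real.exp (2 * c + 2) * Real.exp c := by
          rw [← Real.exp_add]; ring_nf
        rw [e]; ring

end DoubleSum

end Literature.NumberTheory.LFunctions.Zhang2022.Sec18SjNorm
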